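import Mathlib.Analysis.Calculus.MeanValue
import Literature.Analysis.FunctionSpaces.TorusFluidGlueProofs
import Literature.Analysis.FunctionSpaces.TorusLerayHelmholtz
import HarnessLib

/-!
# Classical Navier–Stokes solutions on the flat torus: restriction of the time set,
# conservation of the mean, pressure normalisation, and gluing in time

Function-space support file (all results proved; no definitions, no named facts) for the
accepted notion `Torus.IsClassicalNSSolutionOn S ν f u p` of `TorusFluidGlue` (jointly smooth
velocity and pressure on `S × T^d`, momentum equation with the one-sided time derivative
`Torus.timeDerivWithin S`, incompressibility). It provides the torus twins of the elementary
bookkeeping that the whole-space file `Literature/Analysis/FluidPDE/ClassicalSolutionGlue`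
proves for `Literature.Analysis.FluidPDE.IsClassicalNSSolutionOn`:

* `Torus.IsClassicalNSSolutionOn.mono` — restriction to a smaller time set of unique
  differentiability (the one-sided time derivative is unchanged there,
  `Torus.IsSmoothSpaceTimeOn.timeDerivWithin_eq_of_subset`);
* `Torus.IsClassicalNSSolutionOn.hasDerivWithinAt_integral_velocity`,
  `Torus.IsClassicalNSSolutionOn.integral_velocity_eq`, `Torus.IsClassicalNSSolutionOn.hasZeroMean_of_hasZeroMean`
  — **conservation of the mean velocity**: on a convex time set `d/dt ∫ u(t) = ∫ f(t)`
  (`∫ Δu = ∫ ∇p = ∫ (u·∇)u = 0` on the torus), so for a mean-zero (e.g. zero) force the spatial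
  average of the velocity is constant in time;
* `Torus.IsClassicalNSSolutionOn.gradient_pressure_eq_of_eventuallyEq`,
  `Torus.IsClassicalNSSolutionOn.pressure_sub_eq_of_eventuallyEq` — **the velocity determines
  the pressure gradient**: two classical solutions whose velocities agree near an interior time
  have the same pressure gradient there, hence pressures differing by a function of time alone;
* `Torus.IsClassicalNSSolutionOn.glue_Ioi` — **gluing along an open overlap**: a classical
  solution on `(c, T)` and one on `(a, ∞)`, `c ≤ a < T`, whose velocities agree on `(a, T)`,
  glue (velocity of the first before `T`, of the second from `T` on; pressures normalised by
  their value at a base point `x₀`) to a classical solution on `(c, ∞)`. Joint smoothness is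
  local (Mathlib `contDiffOn_of_locally_contDiffOn`); all time sets here are open, so every
  time derivative is two-sided.

These are the (folklore) glue steps of "extend a solution given on a finite time interval by a
solution issued from its value at a later time", as used e.g. in Coiculescu–Palasek 2025, §5
(last paragraph) and in every continuation argument (Robinson–Rodrigo–Sadowski 2016, proof of
Thm. 8.14 / Lemma 6.11: restart at a later time and identify on the overlap).

## Mathlib / tree search

Tree (`lean search 'Torus.IsClassicalNSSolutionOn\.(mono|glue|translate)'`): nothing on the
torus side; the whole-space twins are `IsClassicalNSSolutionOn.mono` (`ClassicalSolution.lean`)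
and `IsClassicalNSSolutionOn.glue`, `gradient_pressure_eq_of_eventuallyEq`,
`pressure_sub_apply_zero_eq_of_eventuallyEq` (`ClassicalSolutionGlue.lean`), whose proofs are
transported here verbatim. Torus calculus reused: `Torus.IsSmoothSpaceTimeOn.hasDerivWithinAt_slice`,
`….hasDerivWithinAt_integral` (`TorusCalculusProofs`), `Torus.fderiv_sub`, `Torus.gradient_sub`
(`TorusLerayHelmholtz`), `Torus.integral_gradient_eq_zero` (`TorusConvolution`),
`Torus.integral_fderiv_apply_eq_zero_of_isDivFree`, `Torus.integral_partialDeriv_eq_zero_holds`,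
`Torus.fderiv_lift`, `Torus.inner_gradient_left`. Mathlib: `contDiffOn_of_locally_contDiffOn`,
`derivWithin_of_mem_nhds`, `Filter.EventuallyEq.deriv_eq`, `is_const_of_fderiv_eq_zero`,
`Convex.norm_image_sub_le_of_norm_hasDerivWithin_le`.

## References

* J. C. Robinson, J. L. Rodrigo, W. Sadowski, *The Three-Dimensional Navier–Stokes Equations.
  Classical Theory*, CUP 2016, §6.3 (Lemma 6.11) and §8.1 (restart and identification on the
  overlap). [RobinsonRodrigoSadowskiCUP2016]
* M. P. Coiculescu, S. Palasek, Invent. Math. 244 (2025) = arXiv:2503.14699, §5, last paragraph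
  (extension of the solutions on `[0,1]` to global ones). [CoiculescuPalasek2025]
-/

open MeasureTheory Set Filter
open _root_.Topology
open scoped InnerProductSpace ContDiff

noncomputable section

namespace Literature.Analysis.FunctionSpaces

namespace Torus

variable {d : Type*} [Fintype d] [DecidableEq d]

/-! ## Restriction of the time set -/

section Mono

variable {F : Type*} [NormedAddCommGroup F] [NormedSpace ℝ F]

omit [DecidableEq d] in
/-- On a smaller time set of unique differentiability the one-sided time derivative of a jointly
smooth field is unchanged (Mathlib `HasDerivWithinAt.mono`, `HasDerivWithinAt.derivWithin`);
torus twin of `Literature.Analysis.FluidPDE.IsSmoothSpaceTimeOn.timeDerivWithin_eq_of_subset`. [folklore] -/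
theorem IsSmoothSpaceTimeOn.timeDerivWithin_eq_of_subset {S S' : Set ℝ}
    {w : ℝ → UnitAddTorus d → F} (h : IsSmoothSpaceTimeOn S w) (hS' : S' ⊆ S)
    (hU : UniqueDiffOn ℝ S') {t : ℝ} (ht : t ∈ S') (x : UnitAddTorus d) :
    Torus.timeDerivWithin S' w t x = Torus.timeDerivWithin S w t x :=
  ((h.hasDerivWithinAt_slice (hS' ht) x).mono hS').derivWithin (hU t ht)

omit [DecidableEq d] in
/-- A jointly smooth field frozen at a base point, `(t, x) ↦ p t x₀`, is jointly smooth on the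
same time set (composition of the space–time lift with `(t, y) ↦ (t, repr x₀)`). [folklore] -/
theorem IsSmoothSpaceTimeOn.slice_apply_const {S : Set ℝ} {p : ℝ → UnitAddTorus d → F}
    (hp : IsSmoothSpaceTimeOn S p) (x₀ : UnitAddTorus d) :
    IsSmoothSpaceTimeOn S (fun t (_ : UnitAddTorus d) => p t x₀) := by
  have h1 : ContDiffOn ℝ ∞ (stLift p ∘ fun z : ℝ × EuclideanSpace ℝ d => (z.1, repr x₀))
      (S ×ˢ (univ : Set (EuclideanSpace ℝ d))) :=
    hp.comp (contDiff_fst.prodMk contDiff_const).contDiffOn fun z hz => ⟨hz.1, mem_univ _⟩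
  refine h1.congr fun z _ => ?_
  simp [stLift, proj_repr]

omit [DecidableEq d] in
/-- Normalising a jointly smooth field by its value at a base point preserves joint smoothness:
`(t, x) ↦ p t x - p t x₀` (the normalised pressure used in gluing). [folklore] -/
theorem IsSmoothSpaceTimeOn.sub_slice_apply_const {S : Set ℝ} {p : ℝ → UnitAddTorus d → F}
    (hp : IsSmoothSpaceTimeOn S p) (x₀ : UnitAddTorus d) :
    IsSmoothSpaceTimeOn S (fun t x => p t x - p t x₀) :=
  hp.sub (hp.slice_apply_const x₀)

variable {S S' : Set ℝ} {ν : ℝ} {f u : ℝ → UnitAddTorus d → EuclideanSpace ℝ d}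
  {p : ℝ → UnitAddTorus d → ℝ}

/-- **Restriction of the time set.** A classical solution on `S` is a classical solution on any
`S' ⊆ S` of unique differentiability (`S'` open, or any interval with nonempty interior): the
one-sided time derivative within `S'` agrees with the one within `S` for fields differentiable
within `S`. Torus twin of `Literature.Analysis.FluidPDE.IsClassicalNSSolutionOn.mono`. [folklore] -/
theorem IsClassicalNSSolutionOn.mono (h : IsClassicalNSSolutionOn S ν f u p) (hS' : S' ⊆ S)
    (hU : UniqueDiffOn ℝ S') : IsClassicalNSSolutionOn S' ν f u p where
  smooth_velocity := h.smooth_velocity.mono hS'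
  smooth_pressure := h.smooth_pressure.mono hS'
  momentum t ht x := by
    rw [h.smooth_velocity.timeDerivWithin_eq_of_subset hS' hU ht x]
    exact h.momentum t (hS' ht) x
  divFree t ht := h.divFree t (hS' ht)

end Mono

/-! ## Conservation of the mean velocity -/

section Mean

variable {F : Type*} [NormedAddCommGroup F] [NormedSpace ℝ F]

/-- `∫_{T^d} Δv = 0` for a smooth field (`Δ = ∑ᵢ ∂ᵢ∂ᵢ` and `∫ ∂ᵢ(·) = 0`,
`Torus.integral_partialDeriv_eq_zero`). [folklore] -/
theorem integral_laplacian_eq_zero_of_isSmooth {v : UnitAddTorus d → F} (hv : IsSmooth v) :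
    ∫ x, laplacian v x = 0 := by
  have h : laplacian v = fun x => ∑ i, partialDeriv i (partialDeriv i v) x :=
    funext (laplacian_eq_sum_partialDeriv_partialDeriv hv)
  rw [h, integral_finsetSum _ fun i _ => ((hv.partialDeriv i).partialDeriv i).integrable]
  exact Finset.sum_eq_zero fun i _ => integral_partialDeriv_eq_zero_holds (hv.partialDeriv i) i

variable {S : Set ℝ} {ν : ℝ} {f u : ℝ → UnitAddTorus d → EuclideanSpace ℝ d}
  {p : ℝ → UnitAddTorus d → ℝ}

/-- `∫_{T^d} (v·∇)v = 0` for a smooth divergence-free field (`(v·∇)v = ∑ⱼ ∂ⱼ(vⱼ v)`; the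
transport identity `Torus.integral_fderiv_apply_eq_zero_of_isDivFree`). [folklore] -/
theorem integral_convect_self_eq_zero {v : UnitAddTorus d → EuclideanSpace ℝ d} (hv : IsSmooth v)
    (hdiv : IsDivFree v) : ∫ x, convect v v x = 0 :=
  integral_fderiv_apply_eq_zero_of_isDivFree hv hv hdiv

/-- **The mean velocity evolves by the mean force.** For a classical solution on a convex time
set `S`, `t ↦ ∫ u(t, x) dx` has one-sided derivative `∫ f(t, x) dx` within `S` at every
`t ∈ S`: differentiate under the integral (`Torus.IsSmoothSpaceTimeOn.hasDerivWithinAt_integral`),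
insert `∂ₜu = νΔu − ∇p + f − (u·∇)u`, and use `∫ Δu = ∫ ∇p = ∫ (u·∇)u = 0` on the torus. At an
isolated point of `S` the statement is vacuous. [folklore] -/
theorem IsClassicalNSSolutionOn.hasDerivWithinAt_integral_velocity
    (h : IsClassicalNSSolutionOn S ν f u p) (hS : Convex ℝ S) {t : ℝ} (ht : t ∈ S) :
    HasDerivWithinAt (fun s => ∫ x, u s x) (∫ x, f t x) S t := by
  by_cases hacc : AccPt t (𝓟 S)
  swap
  · exact HasFDerivWithinAt.of_not_accPt hacc
  have hU : UniqueDiffOn ℝ S :=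
    uniqueDiffOn_convex hS (interior_nonempty_of_convex_of_accPt hS ht hacc)
  have hu : IsSmoothSpaceTimeOn S u := h.smooth_velocity
  have hut : IsSmooth (u t) := hu.isSmooth_slice ht
  have hpt : IsSmooth (p t) := h.smooth_pressure.isSmooth_slice ht
  have hA : IsSmooth (timeDerivWithin S u t) := hu.isSmooth_timeDerivWithin hU ht
  refine (hu.hasDerivWithinAt_integral hS ht).congr_deriv ?_
  have hf_eq : ∀ x, f t x = timeDerivWithin S u t x + convect (u t) (u t) x -
      ν • laplacian (u t) x + gradient (p t) x := by
    intro x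
    rw [h.momentum t ht x]
    abel
  have iA : Integrable (fun x => timeDerivWithin S u t x) volume := hA.integrable
  have iC : Integrable (fun x => convect (u t) (u t) x) volume := (hut.convect hut).integrable
  have iL : Integrable (fun x => ν • laplacian (u t) x) volume := (hut.laplacian.smul ν).integrable
  have iG : Integrable (fun x => gradient (p t) x) volume := hpt.gradient.integrable
  symm
  calc ∫ x, f t x
      = ∫ x, (timeDerivWithin S u t x + convect (u t) (u t) x - ν • laplacian (u t) x +
          gradient (p t) x) := integral_congr_ae (ae_of_all _ hf_eq)
    _ = (∫ x, timeDerivWithin S u t x) + (∫ x, convect (u t) (u t) x) -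
          (∫ x, ν • laplacian (u t) x) + ∫ x, gradient (p t) x := by
        rw [integral_add ?_ iG, integral_sub ?_ iL, integral_add iA iC]
        · exact iA.add iC
        · exact (iA.add iC).sub iL
    _ = ∫ x, timeDerivWithin S u t x := by
        rw [integral_convect_self_eq_zero hut (h.divFree t ht), integral_smul,
          integral_laplacian_eq_zero_of_isSmooth hut, integral_gradient_eq_zero hpt]
        simp

/-- **Conservation of the mean velocity for mean-zero forces.** If the force has zero spatial
average at every time of a convex time set `S` (e.g. `f = 0`), then `∫ u(t) = ∫ u(s)` for all
`s, t ∈ S` (a function with vanishing one-sided derivative on a convex set is constant, Mathlib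
`Convex.norm_image_sub_le_of_norm_hasDerivWithin_le`). [folklore] -/
theorem IsClassicalNSSolutionOn.integral_velocity_eq (h : IsClassicalNSSolutionOn S ν f u p)
    (hS : Convex ℝ S) (hf : ∀ t ∈ S, ∫ x, f t x = 0) {s t : ℝ} (hs : s ∈ S) (ht : t ∈ S) :
    ∫ x, u t x = ∫ x, u s x := by
  have hd : ∀ τ ∈ S, HasDerivWithinAt (fun s => ∫ x, u s x) ((fun _ => 0 : ℝ → _) τ) S τ := by
    intro τ hτ
    have h1 := h.hasDerivWithinAt_integral_velocity hS hτ
    rwa [hf τ hτ] at h1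
  have h0 := hS.norm_image_sub_le_of_norm_hasDerivWithin_le (C := 0) hd (fun τ _ => by simp) hs ht
  rw [zero_mul, norm_le_zero_iff, sub_eq_zero] at h0
  exact h0

/-- **Unforced classical solutions keep a zero mean**: if `∫ u(s) = 0` at one time `s` of a
convex time set, then `∫ u(t) = 0` at every other time `t` of it. [folklore] -/
theorem IsClassicalNSSolutionOn.hasZeroMean_of_hasZeroMean (h : IsClassicalNSSolutionOn S ν 0 u p)
    (hS : Convex ℝ S) {s t : ℝ} (hs : s ∈ S) (ht : t ∈ S) (h0 : HasZeroMean (u s)) :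
    HasZeroMean (u t) := by
  unfold HasZeroMean at h0 ⊢
  rw [h.integral_velocity_eq hS (fun τ _ => by simp) hs ht, h0]

end Mean

/-! ## The velocity determines the pressure gradient -/

section Pressure

variable {ν : ℝ} {f : ℝ → UnitAddTorus d → EuclideanSpace ℝ d}

omit [DecidableEq d] in
/-- `∇(φ − c) = ∇φ` for a constant `c` (Mathlib `fderiv_sub_const` on the re-centred lift). [folklore] -/
theorem gradient_sub_const_apply (φ : UnitAddTorus d → ℝ) (c : ℝ) (x : UnitAddTorus d) :
    Torus.gradient (fun y => φ y - c) x = Torus.gradient φ x := by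
  unfold Torus.gradient _root_.gradient
  have h : liftAt (fun y => φ y - c) x = fun v => liftAt φ x v - c := rfl
  rw [h, fderiv_sub_const]

/-- **The velocity determines the pressure gradient.** If two classical solutions (same `ν`,
same force) have velocities agreeing near a time `t` interior to both time sets, then
`∇p₁(t, ·) = ∇p₂(t, ·)`: subtract the momentum equations; at an interior time the one-sided
time derivatives are two-sided (`derivWithin_of_mem_nhds`) and agree for fields coinciding near
`t` (`Filter.EventuallyEq.deriv_eq`). Torus twin of
`Literature.Analysis.FluidPDE.IsClassicalNSSolutionOn.gradient_pressure_eq_of_eventuallyEq`. [folklore] -/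
theorem IsClassicalNSSolutionOn.gradient_pressure_eq_of_eventuallyEq {S₁ S₂ : Set ℝ}
    {u₁ u₂ : ℝ → UnitAddTorus d → EuclideanSpace ℝ d} {p₁ p₂ : ℝ → UnitAddTorus d → ℝ}
    (h₁ : IsClassicalNSSolutionOn S₁ ν f u₁ p₁) (h₂ : IsClassicalNSSolutionOn S₂ ν f u₂ p₂)
    {t : ℝ} (ht₁ : S₁ ∈ 𝓝 t) (ht₂ : S₂ ∈ 𝓝 t) (heq : ∀ᶠ τ in 𝓝 t, u₁ τ = u₂ τ)
    (x : UnitAddTorus d) : gradient (p₁ t) x = gradient (p₂ t) x := by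
  have heqt : u₁ t = u₂ t := heq.self_of_nhds
  have hd : timeDerivWithin S₁ u₁ t x = timeDerivWithin S₂ u₂ t x := by
    simp only [timeDerivWithin]
    rw [derivWithin_of_mem_nhds ht₁, derivWithin_of_mem_nhds ht₂]
    exact Filter.EventuallyEq.deriv_eq (heq.mono fun τ hτ => congrFun hτ x)
  have hm₁ := h₁.momentum t (mem_of_mem_nhds ht₁) x
  have hm₂ := h₂.momentum t (mem_of_mem_nhds ht₂) x
  rw [hd, heqt] at hm₁
  have h12 := hm₁.symm.trans hm₂
  simpa using h12

/-- **Pressures with the same velocity differ by a function of time.** Under the hypotheses of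
`gradient_pressure_eq_of_eventuallyEq`, `p₁(t, x) − p₁(t, x₀) = p₂(t, x) − p₂(t, x₀)` for all
`x, x₀`: the lift of `p₁(t) − p₂(t)` to `ℝ^d` is a `C¹` function with vanishing derivative
(`Torus.fderiv_lift`, `Torus.inner_gradient_left`), hence constant (Mathlib
`is_const_of_fderiv_eq_zero`). [folklore] -/
theorem IsClassicalNSSolutionOn.pressure_sub_eq_of_eventuallyEq {S₁ S₂ : Set ℝ}
    {u₁ u₂ : ℝ → UnitAddTorus d → EuclideanSpace ℝ d} {p₁ p₂ : ℝ → UnitAddTorus d → ℝ}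
    (h₁ : IsClassicalNSSolutionOn S₁ ν f u₁ p₁) (h₂ : IsClassicalNSSolutionOn S₂ ν f u₂ p₂)
    {t : ℝ} (ht₁ : S₁ ∈ 𝓝 t) (ht₂ : S₂ ∈ 𝓝 t) (heq : ∀ᶠ τ in 𝓝 t, u₁ τ = u₂ τ)
    (x x₀ : UnitAddTorus d) : p₁ t x - p₁ t x₀ = p₂ t x - p₂ t x₀ := by
  have hp₁ : IsSmooth (p₁ t) := h₁.smooth_pressure.isSmooth_slice (mem_of_mem_nhds ht₁)
  have hp₂ : IsSmooth (p₂ t) := h₂.smooth_pressure.isSmooth_slice (mem_of_mem_nhds ht₂)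
  have hψ : IsSmooth (p₁ t - p₂ t) := hp₁.sub hp₂
  have hg0 : ∀ y, Torus.gradient (p₁ t - p₂ t) y = 0 := fun y => by
    rw [gradient_sub (hp₁.isContDiff (by simp)) (hp₂.isContDiff (by simp)),
      h₁.gradient_pressure_eq_of_eventuallyEq h₂ ht₁ ht₂ heq y, sub_self]
  have hD : Differentiable ℝ (lift (p₁ t - p₂ t)) := ContDiff.differentiable hψ (by simp)
  have hzero : ∀ y, _root_.fderiv ℝ (lift (p₁ t - p₂ t)) y = 0 := fun y => by
    rw [fderiv_lift]
    ext w
    rw [← inner_gradient_left, hg0]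
    simp
  have hc := is_const_of_fderiv_eq_zero hD hzero (repr x) (repr x₀)
  rw [lift_repr, lift_repr, Pi.sub_apply, Pi.sub_apply] at hc
  linarith

/-! ## Gluing along an open overlap -/

/-- **Gluing classical solutions on the torus along an open overlap.** Let `(u₁, p₁)` be a
classical solution on `(c, T)` and `(u₂, p₂)` one on `(a, ∞)` (same viscosity and force),
`c ≤ a < T`, with `u₁(t) = u₂(t)` for `t ∈ (a, T)`. Then the velocity equal to `u₁` for `t < T`
and to `u₂` for `t ≥ T`, with the pressures normalised at the base point `x₀`
(`pᵢ(t, x) − pᵢ(t, x₀)`), is a classical solution on `(c, ∞)`. Joint smoothness is local: on the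
open pieces `(c, T) × T^d` and `(a, ∞) × T^d` the glued fields coincide with
`(u₁, p₁ − p₁(·, x₀))` resp. `(u₂, p₂ − p₂(·, x₀))` (for the pressures by
`pressure_sub_eq_of_eventuallyEq` on the overlap). All time sets are open, so the momentum
equation at `t < T` is that of `(u₁, p₁)` and at `t ≥ T` that of `(u₂, p₂)` (two-sided time
derivatives of fields agreeing near `t`). Torus twin of
`Literature.Analysis.FluidPDE.IsClassicalNSSolutionOn.glue`. [folklore] -/
theorem IsClassicalNSSolutionOn.glue_Ioi {c a T : ℝ}
    {u₁ u₂ : ℝ → UnitAddTorus d → EuclideanSpace ℝ d} {p₁ p₂ : ℝ → UnitAddTorus d → ℝ}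
    (h₁ : IsClassicalNSSolutionOn (Ioo c T) ν f u₁ p₁) (h₂ : IsClassicalNSSolutionOn (Ioi a) ν f u₂ p₂)
    (hca : c ≤ a) (haT : a < T) (heq : ∀ t ∈ Ioo a T, u₁ t = u₂ t) (x₀ : UnitAddTorus d) :
    IsClassicalNSSolutionOn (Ioi c) ν f (fun t => if t < T then u₁ t else u₂ t)
      (fun t => if t < T then (fun x => p₁ t x - p₁ t x₀) else fun x => p₂ t x - p₂ t x₀) := by
  -- the two open pieces of `(c, ∞)`
  have hI₂ : Ioi c ∩ Ioi a = Ioi a := inter_eq_right.2 (Ioi_subset_Ioi hca)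
  have hP₁ : (Ioi c ×ˢ (univ : Set (EuclideanSpace ℝ d))) ∩ Iio T ×ˢ univ = Ioo c T ×ˢ univ := by
    rw [prod_inter_prod, Ioi_inter_Iio, inter_self]
  have hP₂ : (Ioi c ×ˢ (univ : Set (EuclideanSpace ℝ d))) ∩ Ioi a ×ˢ univ = Ioi a ×ˢ univ := by
    rw [prod_inter_prod, hI₂, inter_self]
  -- on the overlap the velocities agree near every point and the normalised pressures agree
  have hov : ∀ t ∈ Ioo a T, ∀ᶠ τ in 𝓝 t, u₁ τ = u₂ τ := fun t ht => by
    filter_upwards [Ioo_mem_nhds ht.1 ht.2] with τ hτ using heq τ hτ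
  have hpr : ∀ t ∈ Ioo a T, ∀ x, p₁ t x - p₁ t x₀ = p₂ t x - p₂ t x₀ := fun t ht x =>
    h₁.pressure_sub_eq_of_eventuallyEq h₂ (Ioo_mem_nhds (hca.trans_lt ht.1) ht.2)
      (Ioi_mem_nhds ht.1) (hov t ht) x x₀
  refine ⟨?_, ?_, ?_, ?_⟩
  · -- smoothness of the glued velocity
    refine contDiffOn_of_locally_contDiffOn fun z hz => ?_
    obtain ⟨t, y⟩ := z
    by_cases htT : t < T
    · refine ⟨Iio T ×ˢ univ, isOpen_Iio.prod isOpen_univ, ⟨htT, mem_univ _⟩, ?_⟩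
      rw [hP₁]
      refine h₁.smooth_velocity.congr fun z hz => ?_
      obtain ⟨τ, y'⟩ := z
      have hτ : τ < T := hz.1.2
      simp only [stLift_apply, if_pos hτ]
    · refine ⟨Ioi a ×ˢ univ, isOpen_Ioi.prod isOpen_univ,
        ⟨haT.trans_le (not_lt.1 htT), mem_univ _⟩, ?_⟩
      rw [hP₂]
      refine h₂.smooth_velocity.congr fun z hz => ?_
      obtain ⟨τ, y'⟩ := z
      have hτ : τ ∈ Ioi a := hz.1
      by_cases hτT : τ < T
      · simp only [stLift_apply, if_pos hτT, heq τ ⟨hτ, hτT⟩]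
      · simp only [stLift_apply, if_neg hτT]
  · -- smoothness of the glued (normalised) pressure
    refine contDiffOn_of_locally_contDiffOn fun z hz => ?_
    obtain ⟨t, y⟩ := z
    by_cases htT : t < T
    · refine ⟨Iio T ×ˢ univ, isOpen_Iio.prod isOpen_univ, ⟨htT, mem_univ _⟩, ?_⟩
      rw [hP₁]
      refine (h₁.smooth_pressure.sub_slice_apply_const x₀).congr fun z hz => ?_
      obtain ⟨τ, y'⟩ := z
      have hτ : τ < T := hz.1.2
      simp only [stLift_apply, if_pos hτ]
    · refine ⟨Ioi a ×ˢ univ, isOpen_Ioi.prod isOpen_univ,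
        ⟨haT.trans_le (not_lt.1 htT), mem_univ _⟩, ?_⟩
      rw [hP₂]
      refine (h₂.smooth_pressure.sub_slice_apply_const x₀).congr fun z hz => ?_
      obtain ⟨τ, y'⟩ := z
      have hτ : τ ∈ Ioi a := hz.1
      by_cases hτT : τ < T
      · simp only [stLift_apply, if_pos hτT, hpr τ ⟨hτ, hτT⟩]
      · simp only [stLift_apply, if_neg hτT]
  · -- the momentum equation
    intro t ht x
    have hct : c < t := ht
    by_cases htT : t < T
    · have hev : (fun τ => (if τ < T then u₁ τ else u₂ τ) x) =ᶠ[𝓝 t] fun τ => u₁ τ x := by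
        filter_upwards [Iio_mem_nhds htT] with τ hτ
        rw [if_pos (show τ < T from hτ)]
      have hD : timeDerivWithin (Ioi c) (fun τ => if τ < T then u₁ τ else u₂ τ) t x =
          timeDerivWithin (Ioo c T) u₁ t x := by
        simp only [timeDerivWithin]
        rw [derivWithin_of_mem_nhds (Ioi_mem_nhds hct),
          derivWithin_of_mem_nhds (Ioo_mem_nhds hct htT)]
        exact hev.deriv_eq
      rw [hD]
      simp only [if_pos htT]
      rw [gradient_sub_const_apply]
      exact h₁.momentum t ⟨hct, htT⟩ x
    · have hTt : T ≤ t := not_lt.1 htT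
      have hat : a < t := haT.trans_le hTt
      have hev : (fun τ => (if τ < T then u₁ τ else u₂ τ) x) =ᶠ[𝓝 t] fun τ => u₂ τ x := by
        filter_upwards [Ioi_mem_nhds hat] with τ hτ
        by_cases hτT : τ < T
        · rw [if_pos hτT, heq τ ⟨hτ, hτT⟩]
        · rw [if_neg hτT]
      have hD : timeDerivWithin (Ioi c) (fun τ => if τ < T then u₁ τ else u₂ τ) t x =
          timeDerivWithin (Ioi a) u₂ t x := by
        simp only [timeDerivWithin]
        rw [derivWithin_of_mem_nhds (Ioi_mem_nhds hct), derivWithin_of_mem_nhds (Ioi_mem_nhds hat)]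
        exact hev.deriv_eq
      rw [hD]
      simp only [if_neg htT]
      rw [gradient_sub_const_apply]
      exact h₂.momentum t hat x
  · -- incompressibility
    intro t ht
    by_cases htT : t < T
    · simp only [if_pos htT]
      exact h₁.divFree t ⟨ht, htT⟩
    · simp only [if_neg htT]
      exact h₂.divFree t (haT.trans_le (not_lt.1 htT))

end Pressure

end Torus

end Literature.Analysis.FunctionSpaces
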